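import Mathlib
import HarnessLib
import Summits.NavierStokesRegularity.NavierStokesRegularity.Theorems.PoloidalWindowDoorLrcModEntireTimeWebPackageOfPin
import Summits.NavierStokesRegularity.NavierStokesRegularity.Theorems.PoloidalWindowDoorLrcModEntireHorizontalGermAtTime
import Summits.NavierStokesRegularity.NavierStokesRegularity.Theorems.PoloidalWindowDoorLrcModEntireSheetFlatten

/-!
# Route `PoloidalWindowDoor`, item `LrcModEntire` (stmt-NavierStokesRegularity-20428), cells (Q4-*) of the (TH) column —
# THE LINE LEVER AT A NON-SONIC TIME `−1+τ` (T2B-g17 §1 case II / §5(5f))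

Cell ns-regularity-ideate, stub-worker seat ns-poloidal-K2-p2 g16 under the LEAD of item 20428 (ns-poloidal-K2-p3 g17);
`--supports stmt-NavierStokesRegularity-20428 --as helper`.  Memo `Cruxes/LrcModEntire/T2B-g17.md` §1 CASE II: «at every nearby τ ≠ 0 the g16 LINE lever applies to the
base web `W_τ(·,0)` unless that web is CURVED»; §5(5f): «if it is straight to all orders in τ for all τ it is straight and the lever kills at any non-sonic τ».
This file is that lever in the kernel, HOT-FREE (no hypothesis at `t = −1` on the branch except the non-zero hot value used by the final Liouville step):

★ `line_lever_at_time` — (Q4) binders (class, poloidal, slab slope form, web Fermat law, strict concavity over the STRAIGHT branch `Γ s = s·Γ′(0)`), a time `τ` with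
`|τ| < δ, ρ, 1/2`, `μ(−1+τ, 0) < 1`, the PIN «the cross-section maximiser at height 0 and time τ is s-free» (base web = an `e`-parallel line), NON-SONIC at `τ`
(`R(τ,·)` not affine on `|z| < δ`) and `U₂(−1,0) ≠ 0` ⊢ `False`.
PROOF = LEAD g16's `q4line_core` steps 12–15 at time `−1+τ`: parallel webs + Huygens (`…TimeWebPackageOfPin.time_web_package_of_pin`); non-sonic and `R(τ,·) ∈ C^ω`
⇒ a non-characteristic height (`affine_on_window_of_deriv_deriv_eq_zero`); Cauchy–Kovalevskaya across the flat sheet (`…SheetFlatten.fderiv_apply_eq_zero_on_slab`)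
⇒ `∂_eU₂(−1+τ,·) = 0` on an open slab; the time-`t₀` horizontal germ endgame (`…HorizontalGermAtTime.false_of_local_horizontalDeriv_two_eq_zero_at`).

WHAT THIS IS NOT: not a claim about Navier–Stokes regularity; no registered slot closes (the lever is a tool for the time dichotomy of `stub_Q4sonicLineNeg` /
`stub_Q4curved`); items 20428 / 19708 / 27893 OPEN (bears_on LADDER-NS N0).
-/

noncomputable section

-- the summit and its single sub-problem share the name (CONVENTIONS §1), as in every Theorems file
set_option linter.dupNamespace false

namespace Summit.NavierStokesRegularity.NavierStokesRegularity.Theorems.PoloidalWindowDoorLrcModEntireLineLeverAtTime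

open Set Function Filter Topology Metric
open scoped RealInnerProductSpace InnerProductSpace Laplacian ContDiff
open Literature.Analysis Literature.Analysis.FluidPDE Literature.Analysis.UnboundedOperators
open Summit.NavierStokesRegularity.NavierStokesRegularity.Theorems.PoloidalWindowDoorLrcModEntireSheetFlattenTools
open Summit.NavierStokesRegularity.NavierStokesRegularity.Theorems.PoloidalWindowDoorLrcModEntireSheetFlatten
open Summit.NavierStokesRegularity.NavierStokesRegularity.Theorems.PoloidalWindowDoorLrcModEntireQ4LineTools
open Summit.NavierStokesRegularity.NavierStokesRegularity.Theorems.PoloidalWindowDoorLrcModEntireQ4LineWeb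
open Summit.NavierStokesRegularity.NavierStokesRegularity.Theorems.PoloidalWindowDoorPoloidalWindowRigidityTimeHeightShearLinearSlice
open Summit.NavierStokesRegularity.NavierStokesRegularity.Theorems.PoloidalWindowDoorPoloidalWindowRigidityConstantShearSlice
open Summit.NavierStokesRegularity.NavierStokesRegularity.Theorems.LocalSineTubeDoorProfileAlignedWindowRigidityAncient
open Summit.NavierStokesRegularity.NavierStokesRegularity.Theorems.PoloidalWindowDoorLrcModEntireTimeWebPackageOfPin
open Summit.NavierStokesRegularity.NavierStokesRegularity.Theorems.PoloidalWindowDoorLrcModEntireHorizontalGermAtTime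

/-- ★ **THE LINE LEVER AT A NON-SONIC TIME.**  See the module docstring. -/
theorem line_lever_at_time {C : ℝ} {U : ℝ → EuclideanSpace ℝ (Fin 3) → EuclideanSpace ℝ (Fin 3)} {Γ νΓ : ℝ → EuclideanSpace ℝ (Fin 3)}
    {R μ : ℝ → ℝ → ℝ} {σ r δ ρ τ : ℝ}
    (hUrate : HasTypeITimeDecay C U) (hUcont : ContinuousOn (uncurry U) (Iio (0 : ℝ) ×ˢ univ))
    (hUmild : ∀ s t : ℝ, s < t → t < 0 → ∀ x, U t x = heatExtension (U s) (t - s) x - oseenDuhamel 1 s U U t x)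
    (hUdiv : ∀ t < 0, VectorCalculus.IsDivFree (U t))
    (hUpol : ∀ s < 0, ∀ q, ⟪curl (U s) q, EuclideanSpace.single 2 1⟫_ℝ = 0)
    (hσ : σ = 1 ∨ σ = -1)
    (hΓ2 : ∀ s, Γ s 2 = 0) (hΓunit : ∀ s, ‖deriv Γ s‖ = 1)
    (hν : ∀ s, νΓ s = WithLp.toLp 2 ![-(deriv Γ s 1), deriv Γ s 0, 0])
    (hline : ∀ s : ℝ, Γ s = s • deriv Γ 0)
    (hδ : 0 < δ)
    (hconc : ∀ τ z : ℝ, |τ| < δ → |z| < δ → ∀ s : ℝ, ∀ n ∈ Ioo (-r) r,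
      fderiv ℝ (fderiv ℝ (fun y => σ * U (-1 + τ) y 2)) (Γ s + n • νΓ s + z • EuclideanSpace.single 2 (1 : ℝ)) (νΓ s) (νΓ s) < 0)
    (hweb : ∀ τ₀ z₀ : ℝ, |τ₀| < δ → |z₀| < δ → ∀ s₀ : ℝ, ∃ n₀ ∈ Ioo (-r) r,
      σ * U (-1 + τ₀) (Γ s₀ + n₀ • νΓ s₀ + z₀ • EuclideanSpace.single 2 (1 : ℝ)) 2 = R τ₀ z₀ ∧
      (∀ n ∈ Icc (-r) r, n ≠ n₀ → σ * U (-1 + τ₀) (Γ s₀ + n • νΓ s₀ + z₀ • EuclideanSpace.single 2 (1 : ℝ)) 2 < R τ₀ z₀) ∧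
      DifferentiableAt ℝ (uncurry R) (τ₀, z₀) ∧
      fderiv ℝ (uncurry fun τ y => σ * U (-1 + τ) y 2) (τ₀, Γ s₀ + n₀ • νΓ s₀ + z₀ • EuclideanSpace.single 2 (1 : ℝ)) =
        (fderiv ℝ (uncurry R) (τ₀, z₀)).comp
          ((ContinuousLinearMap.fst ℝ ℝ (EuclideanSpace ℝ (Fin 3))).prod
            ((EuclideanSpace.proj (2 : Fin 3)).comp (ContinuousLinearMap.snd ℝ ℝ (EuclideanSpace ℝ (Fin 3))))))
    (hρ : 0 < ρ) (hμ3 : ContDiff ℝ 3 (uncurry μ))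
    (hslabU : ∀ t : ℝ, |t + 1| < ρ → ∀ x : EuclideanSpace ℝ (Fin 3), |x 2| < ρ → ∀ b : Fin 3, b ≠ 2 →
      fderiv ℝ (U t) x (EuclideanSpace.single 2 1) b = μ t (x 2) * fderiv ℝ (U t) x (EuclideanSpace.single b 1) 2)
    (hτδ : |τ| < δ) (hτρ : |τ| < ρ) (hτh : |τ| < 1 / 2)
    (hμ1 : μ (-1 + τ) 0 < 1)
    (hpin : ∃ c ∈ Ioo (-r) r, ∀ s : ℝ, σ * U (-1 + τ) (Γ s + c • νΓ s + (0 : ℝ) • EuclideanSpace.single 2 (1 : ℝ)) 2 = R τ 0)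
    (hnson : ¬ (∃ a b : ℝ, ∀ z : ℝ, |z| < δ → R τ z = a + b * z)) (hUne : U (-1) 0 2 ≠ 0) : False := by
  have ht : -1 + τ < 0 := by linarith [(abs_lt.1 hτh).2]
  have hτρ' : |(-1 + τ) + 1| < ρ := by simpa using hτρ
  obtain ⟨δ', d, K, hδ', hδ'δ, hδ'ρ, he2, hunit, hmax, hdω, hRω, hKwin, hHuy⟩ :=
    time_web_package_of_pin hUrate hUcont hUmild hUdiv hUpol hσ hΓ2 hΓunit hν hline hδ hconc hweb hρ hμ3 hslabU hτδ hτρ hτh hμ1 hpin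
  set e : EuclideanSpace ℝ (Fin 3) := deriv Γ 0 with he_def
  have he0 : e ≠ 0 := by
    intro h; rw [h] at hunit; simp at hunit
  have habs : ∀ {c : ℝ} {z : ℝ}, z ∈ Ioo (-c) c ↔ |z| < c := fun {c z} => by rw [mem_Ioo, abs_lt]
  set I : Set ℝ := Ioo (-δ') δ' with hI_def
  have hI : ∀ z ∈ I, |z| < δ ∧ |z| < ρ := fun z hz => ⟨lt_of_lt_of_le (habs.1 hz) hδ'δ, lt_of_lt_of_le (habs.1 hz) hδ'ρ⟩
  have hIδ : I ⊆ Ioo (-δ) δ := fun z hz => habs.2 (hI z hz).1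
  /- the slice at time `−1+τ` -/
  have hUan : AnalyticOnNhd ℝ (U (-1 + τ)) univ := analyticOnNhd_slice hUcont (bdd_of_hasTypeITimeDecay hUrate) hUmild ht
  have hU2 : ContDiff ℝ 2 (U (-1 + τ)) := hUan.contDiff
  have hθan : AnalyticOnNhd ℝ (fun y => U (-1 + τ) y 2) univ := fun x _ =>
    ((EuclideanSpace.proj (𝕜 := ℝ) (2 : Fin 3)).analyticAt _).comp (hUan x (mem_univ _))
  have hμfun : μ (-1 + τ) = uncurry μ ∘ fun z : ℝ => ((-1 + τ : ℝ), z) := by funext z; rfl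
  have hμd : ∀ z : ℝ, DifferentiableAt ℝ (μ (-1 + τ)) z := fun z => by
    rw [hμfun]; exact ((hμ3.differentiable (by norm_num)) _).comp z ((differentiableAt_const _).prodMk differentiableAt_id)
  have hμc : Continuous (μ (-1 + τ)) := by rw [hμfun]; exact hμ3.continuous.comp (continuous_const.prodMk continuous_id)
  /- STEP 12: NON-SONIC ⇒ some height in `(−δ′, δ′)` is non-characteristic. -/
  have hQ : ∃ z₀ ∈ I, deriv d z₀ ^ 2 + μ (-1 + τ) z₀ ≠ 0 := by
    by_contra hall
    push Not at hall
    apply hnson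
    have hR'' : ∀ z ∈ Ioo (-δ') δ', deriv (deriv (R τ)) z = 0 := by
      intro z hz
      have hH := hHuy z hz
      have hq := hall z hz
      have : deriv (deriv (R τ)) z = K z * (deriv d z ^ 2 + μ (-1 + τ) z) := by linear_combination -hH
      rw [this, hq, mul_zero]
    exact affine_on_window_of_deriv_deriv_eq_zero hδ' hδ'δ hRω hR''
  obtain ⟨z₀, hz₀, hQz₀⟩ := hQ
  /- STEP 13: the open set of non-characteristic heights; Cauchy–Kovalevskaya across the flat sheet. -/
  have hdon : ContDiffOn ℝ ω d (Ioo (-δ) δ) := fun z hz => (hdω z (habs.1 hz)).contDiffWithinAt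
  have hd1on : ContDiffOn ℝ 2 (deriv d) (Ioo (-δ) δ) :=
    ((contDiffOn_succ_iff_deriv_of_isOpen isOpen_Ioo).1 (hdon.of_le (m := 2 + 1) le_top)).2.2
  have hQc : ContinuousOn (fun z => deriv d z ^ 2 + μ (-1 + τ) z) I := ((hd1on.continuousOn.mono hIδ).pow 2).add hμc.continuousOn
  set J : Set ℝ := I ∩ (fun z => deriv d z ^ 2 + μ (-1 + τ) z) ⁻¹' ({0}ᶜ) with hJ_def
  have hJsub : J ⊆ I := inter_subset_left
  have hJo : IsOpen J := hQc.isOpen_inter_preimage isOpen_Ioo isOpen_compl_singleton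
  have hz₀J : z₀ ∈ J := ⟨hz₀, hQz₀⟩
  have hdJ : ContDiffOn ℝ ∞ d J := fun z hz => ((hdω z (hI z (hJsub hz)).1).of_le le_top).contDiffWithinAt
  have hplane : ∀ z : ℝ, |z| < ρ → ∀ y : EuclideanSpace ℝ (Fin 3), y 2 = z → ∀ b : Fin 3, b ≠ 2 →
      fderiv ℝ (U (-1 + τ)) y (EuclideanSpace.single 2 (1 : ℝ)) b = μ (-1 + τ) z * fderiv ℝ (U (-1 + τ)) y (EuclideanSpace.single b (1 : ℝ)) 2 := by
    intro z hz y hy b hb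
    have h := hslabU (-1 + τ) hτρ' y (by rw [hy]; exact hz) b hb
    rw [hy] at h; exact h
  have hlawJ : ∀ x : EuclideanSpace ℝ (Fin 3), x 2 ∈ J →
      fderiv ℝ (fun y => fderiv ℝ (fun y' => U (-1 + τ) y' 2) y (EuclideanSpace.single 2 (1 : ℝ))) x (EuclideanSpace.single 2 (1 : ℝ)) =
        -μ (-1 + τ) (x 2) * (fderiv ℝ (fun y => fderiv ℝ (fun y' => U (-1 + τ) y' 2) y (EuclideanSpace.single 0 (1 : ℝ))) x
            (EuclideanSpace.single 0 (1 : ℝ)) +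
          fderiv ℝ (fun y => fderiv ℝ (fun y' => U (-1 + τ) y' 2) y (EuclideanSpace.single 1 (1 : ℝ))) x
            (EuclideanSpace.single 1 (1 : ℝ))) := fun x hx =>
    plane_wave_identity hU2 (fun y => div_coord (hUdiv (-1 + τ) ht) y) (hplane (x 2) (hI _ (hJsub hx)).2) rfl
  have hwebJ : ∀ s : ℝ, ∀ z ∈ J, fderiv ℝ (fun y => U (-1 + τ) y 2) (s • e + d z • Jvec e + z • e2) e = 0 ∧
      fderiv ℝ (fun y => U (-1 + τ) y 2) (s • e + d z • Jvec e + z • e2) (Jvec e) = 0 := by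
    intro s z hz
    have hcrit := (hmax s z (hJsub hz)).2.2.2
    exact ⟨hcrit e he2, hcrit (Jvec e) (by simp [Jvec])⟩
  have hη : ∀ x : EuclideanSpace ℝ (Fin 3), x 2 ∈ J → fderiv ℝ (fun y => U (-1 + τ) y 2) x e = 0 :=
    fderiv_apply_eq_zero_on_slab hθan hJo (μ := μ (-1 + τ)) (fun z _ => hμd z) hdJ he2 hunit hlawJ hwebJ (fun z hz => hz.2)
  /- STEP 14: the slab over `J` is a nonempty open set; the time-`t₀` horizontal germ endgame. -/
  have hVo : IsOpen {x : EuclideanSpace ℝ (Fin 3) | x 2 ∈ J} := hJo.preimage (EuclideanSpace.proj (𝕜 := ℝ) (2 : Fin 3)).continuous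
  have hVne : ({x : EuclideanSpace ℝ (Fin 3) | x 2 ∈ J}).Nonempty := ⟨z₀ • e2, by show (z₀ • e2) 2 ∈ J; simpa [e2] using hz₀J⟩
  exact false_of_local_horizontalDeriv_two_eq_zero_at hUrate hUcont hUmild hUdiv hUpol ht hρ hτρ' hslabU he0 he2 hVo hVne
    (fun x hx => hη x hx) hUne

end Summit.NavierStokesRegularity.NavierStokesRegularity.Theorems.PoloidalWindowDoorLrcModEntireLineLeverAtTime

end
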